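import Literature.Analysis.UnboundedOperators.LinearizedBoltzmannFluxMoments
import Literature.Probability.Distributions.GaussianCoordinateMoments
import HarnessLib

/-!
# The sharp large-speed UPPER bound of the hard-sphere collision frequency of `ℝ³`
# (helper `t12_collisionFrequency_le_pi` of the line `birth`, crux `TwoClocks.EquilibriumFastWindowLD`,
# stmt-AtomisticToContinuum-14440; analytic residue T1/T2 of the corrector transfer)

For the collision frequency `ν(v) = ∫∫ ((v - v_*)·ω)₊ dω dM(v_*)` of the linearised hard-sphere
operator around the normalised Maxwellian of `ℝ³` (`Literature.Analysis.UnboundedOperators.collisionFrequency`)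
the tree has the sharp LOWER bound `ν(v) ≥ π|v|` (`pi_mul_norm_le_collisionFrequency`) and the
non-sharp upper bound `ν(v) ≤ C_ν (1 + |v|)` (`collisionFrequency_le`). Here we prove the matching sharp
UPPER bound

* `t12_collisionFrequency_le_pi` — **`|v| ν(v) ≤ π (|v|² + 3/2)`**, i.e. `ν(v) ≤ π (|v| + 3/(2|v|))`,

so that `|ν(v) − π|v|| ≤ 3π/(2|v|)`: the collision frequency is `π|v|` up to a RELATIVE error
`O(|v|⁻²)`. This is the first input of the large-speed (Lorentz-limit) analysis of `L = -ν + K` behind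
the log-linear corrector bounds of the line `birth` (the indicial multipliers `λ_ℓ(α)` are computed
against the leading term `π|v|` of `ν`). Ingredients: the hat-box identity `∫ ((v-w)·ω)₊ dω = π|v - w|`
(`sphereIntegral_hardSphereKernel_zero`), hence `ν(v) = π ∫ |v - w| dM(w)`
(`collisionFrequency_eq_pi_mul_integral_norm_sub`); the tangent-line bound of the square root
`|v| |v - w| ≤ |v|² − v·w + |w|²/2` (`norm_mul_norm_sub_le`); and the Gaussian moments `∫ w dM = 0`,
`∫ |w|² dM = 3`.

References: Cercignani–Illner–Pulvirenti 1994 §7.2 (2.15) (two-sided bounds of `ν`); Grad 1963 §4.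
-/

noncomputable section

open MeasureTheory ProbabilityTheory Real
open scoped ENNReal BigOperators InnerProductSpace

namespace Summit.AtomisticToContinuum.HydrodynamicLimit.Theorems.ClampedCorrectorBirth

open Literature.Analysis.FluidPDE Literature.MathematicalPhysics.KineticTheory
open Literature.Analysis.UnboundedOperators Literature.Probability.Distributions

/-- `ν(v) = π ∫ |v - w| dM(w)` for the hard-sphere collision frequency of `ℝ³` (the angular integral
is `∫ ((v - w)·ω)₊ dω = π |v - w|`, Archimedes' hat-box theorem in flux form). -/
theorem collisionFrequency_eq_pi_mul_integral_norm_sub (v : EuclideanSpace ℝ (Fin 3)) :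
    collisionFrequency v = Real.pi * ∫ w, ‖v - w‖ ∂stdGaussian (EuclideanSpace ℝ (Fin 3)) := by
  rw [collisionFrequency, ← integral_const_mul]
  refine integral_congr_ae (Filter.Eventually.of_forall fun w => ?_)
  change ∫ ω, hardSphereKernel (v, w) ω ∂sphereMeasure = Real.pi * ‖v - w‖
  rw [integral_congr_ae (Filter.Eventually.of_forall fun ω => hardSphereKernel_eq_sub_zero v w ω)]
  exact sphereIntegral_hardSphereKernel_zero (v - w)

/-- The tangent-line bound of the square root at `|v|²`:
`|v| |v - w| ≤ |v|² − v·w + |w|²/2` (square both sides: the difference is `(v·w − |w|²/2)² ≥ 0`). -/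
theorem norm_mul_norm_sub_le (v w : EuclideanSpace ℝ (Fin 3)) :
    ‖v‖ * ‖v - w‖ ≤ ‖v‖ ^ 2 - ⟪v, w⟫_ℝ + ‖w‖ ^ 2 / 2 := by
  have hsub : ‖v - w‖ ^ 2 = ‖v‖ ^ 2 - 2 * ⟪v, w⟫_ℝ + ‖w‖ ^ 2 := norm_sub_sq_real v w
  have hcs : |⟪v, w⟫_ℝ| ≤ ‖v‖ * ‖w‖ := abs_real_inner_le_norm v w
  have hR : 0 ≤ ‖v‖ ^ 2 - ⟪v, w⟫_ℝ + ‖w‖ ^ 2 / 2 := by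
    have h1 : ⟪v, w⟫_ℝ ≤ ‖v‖ * ‖w‖ := (le_abs_self _).trans hcs
    nlinarith [sq_nonneg (‖v‖ - ‖w‖ / 2), norm_nonneg v, norm_nonneg w]
  have hL : 0 ≤ ‖v‖ * ‖v - w‖ := by positivity
  have hsq : (‖v‖ * ‖v - w‖) ^ 2 ≤ (‖v‖ ^ 2 - ⟪v, w⟫_ℝ + ‖w‖ ^ 2 / 2) ^ 2 := by
    have : (‖v‖ ^ 2 - ⟪v, w⟫_ℝ + ‖w‖ ^ 2 / 2) ^ 2 - (‖v‖ * ‖v - w‖) ^ 2 =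
        (⟪v, w⟫_ℝ - ‖w‖ ^ 2 / 2) ^ 2 := by
      rw [mul_pow, hsub]; ring
    nlinarith [sq_nonneg (⟪v, w⟫_ℝ - ‖w‖ ^ 2 / 2)]
  exact (pow_le_pow_iff_left₀ hL hR two_ne_zero).1 hsq

/-- **Sharp large-speed upper bound of the hard-sphere collision frequency of `ℝ³`**:
`|v| ν(v) ≤ π (|v|² + 3/2)`, i.e. `π|v| ≤ ν(v) ≤ π(|v| + 3/(2|v|))` together with the tree's
`pi_mul_norm_le_collisionFrequency`. Proof: `ν(v) = π ∫ |v - w| dM(w)` and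
`|v| |v - w| ≤ |v|² − v·w + |w|²/2`, whose Gaussian mean is `|v|² + 3/2` (`∫ w dM = 0`, `∫ |w|² dM = 3`). -/
theorem t12_collisionFrequency_le_pi : ∀ v : EuclideanSpace ℝ (Fin 3), ‖v‖ * Literature.Analysis.UnboundedOperators.collisionFrequency v ≤ Real.pi * (‖v‖ ^ 2 + 3 / 2) := by
  intro v
  set μ : Measure (EuclideanSpace ℝ (Fin 3)) := stdGaussian (EuclideanSpace ℝ (Fin 3)) with hμ
  have hid : Integrable (fun w : EuclideanSpace ℝ (Fin 3) => w) μ :=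
    (IsGaussian.memLp_id μ 1 ENNReal.one_ne_top).integrable le_rfl
  have hsub : Integrable (fun w : EuclideanSpace ℝ (Fin 3) => ‖v - w‖) μ :=
    ((integrable_const v).sub hid).norm
  have hinner : Integrable (fun w : EuclideanSpace ℝ (Fin 3) => ⟪v, w⟫_ℝ) μ := hid.const_inner v
  have hsq : Integrable (fun w : EuclideanSpace ℝ (Fin 3) => ‖w‖ ^ 2) μ :=
    (IsGaussian.memLp_id μ 2 (by simp)).integrable_norm_pow (by norm_num)
  have hI0 : ∫ w, ⟪v, w⟫_ℝ ∂μ = 0 := by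
    rw [integral_inner hid, integral_id_stdGaussian, inner_zero_right]
  have hI2 : ∫ w, ‖w‖ ^ 2 ∂μ = 3 := by
    rw [hμ, integral_norm_sq_stdGaussian (EuclideanSpace.basisFun (Fin 3) ℝ), Fintype.card_fin]
    norm_num
  have h1 : Integrable (fun w : EuclideanSpace ℝ (Fin 3) => ‖v‖ ^ 2 - ⟪v, w⟫_ℝ) μ :=
    (integrable_const _).sub hinner
  have h2 : Integrable (fun w : EuclideanSpace ℝ (Fin 3) => ‖w‖ ^ 2 / 2) μ := hsq.div_const 2
  have h12 : Integrable (fun w : EuclideanSpace ℝ (Fin 3) => ‖v‖ ^ 2 - ⟪v, w⟫_ℝ + ‖w‖ ^ 2 / 2) μ :=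
    h1.add h2
  have hbound : ∫ w, ‖v‖ * ‖v - w‖ ∂μ ≤ ∫ w, (‖v‖ ^ 2 - ⟪v, w⟫_ℝ + ‖w‖ ^ 2 / 2) ∂μ :=
    integral_mono (hsub.const_mul _) h12 fun w => norm_mul_norm_sub_le v w
  have hrhs : ∫ w, (‖v‖ ^ 2 - ⟪v, w⟫_ℝ + ‖w‖ ^ 2 / 2) ∂μ = ‖v‖ ^ 2 + 3 / 2 := by
    rw [integral_add h1 h2, integral_sub (integrable_const _) hinner, integral_const, probReal_univ,
      one_smul, hI0, integral_div, hI2]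
    ring
  calc ‖v‖ * collisionFrequency v = Real.pi * ∫ w, ‖v‖ * ‖v - w‖ ∂μ := by
        rw [collisionFrequency_eq_pi_mul_integral_norm_sub, integral_const_mul]; ring
    _ ≤ Real.pi * (‖v‖ ^ 2 + 3 / 2) := by
        rw [← hrhs]
        exact mul_le_mul_of_nonneg_left hbound Real.pi_pos.le

end Summit.AtomisticToContinuum.HydrodynamicLimit.Theorems.ClampedCorrectorBirth
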